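import Summits.PneNP.PneNP.Theorems.ConstantBand.Negative.LoadBearing

/-!
# Route OneSlice, crux `SliceTarget` (stmt-PneNP-2832), line `Sketch-ideator3-r1`: the REPLICA decoupling inequality

A sharper, hypothesis-free form of the fibre decoupling T2 (`stub_fibreMin`), for the regime where the read set `F` is
LARGE (a constant fraction of the slots) and no uniform fibrewise density bound is available: if `f` is determined by the
coordinates in `F`, then for ANY `g` and any finite set `s` of inputs,

`#{x ∈ s : f x ≠ g x} ≥ #{x ∈ s : g x = 1} − Σ_Φ (#{x ∈ Φ : g x = 1})² / #Φ`,

the sum over the fibres `Φ = {x ∈ s : x|_F = ρ|_F}` (indexed by the `F`-patterns `ρ = (e ↦ if e ∈ F then x₀ e else 0)`, `x₀ ∈ s`; written inline, no definition). On each fibre `f` is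
constant, so `#{f ≠ g} ∩ Φ ≥ min(a, b) ≥ ab/(a+b) = a − a²/#Φ` with `a = #{g = 1} ∩ Φ`, `b = #{g = 0} ∩ Φ`. The subtracted
term is the "replica" second moment `#{(x, x̃) : x|_F = x̃|_F, g x = g x̃ = 1}` weighted by `1/#Φ` — the quantity a pair
second-moment computation controls. Generic in the index type; specialised to edge vectors and `slice n j` at the end.
Lead prover-line-stmt-PneNP-2832-0, 2026-08-16.
-/

set_option linter.dupNamespace false

namespace Summit.PneNP.PneNP.Cruxes.SliceTarget.Ideator3Line

open Finset Classical
open Summit.PneNP.PneNP.Theorems.ConstantBand.Negative (Edge slice)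

noncomputable section

section Generic

variable {ι : Type*} [Fintype ι] [DecidableEq ι]

omit [Fintype ι] in
/-- Two inputs have the same `F`-pattern (coordinates outside `F` switched off) iff they agree on `F`. [folklore] -/
theorem pattern_eq_iff (F : Finset ι) (x y : ι → Bool) :
    (fun e => if e ∈ F then x e else false) = (fun e => if e ∈ F then y e else false) ↔ ∀ e ∈ F, x e = y e := by
  constructor
  · intro h e he
    have := congrFun h e
    simpa [he] using this
  · intro h
    funext e
    by_cases he : e ∈ F
    · simp [he, h e he]
    · simp [he]

omit [Fintype ι] [DecidableEq ι] in
/-- `min a b ≥ a − a²/(a+b)` for reals `b ≥ 0` with `a + b > 0`. [folklore] -/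
theorem sub_sq_div_le_min {a b : ℝ} (hb : 0 ≤ b) (hab : 0 < a + b) :
    a - a ^ 2 / (a + b) ≤ min a b := by
  rw [le_min_iff]
  constructor
  · have : 0 ≤ a ^ 2 / (a + b) := by positivity
    linarith
  · rw [sub_le_iff_le_add, ← sub_le_iff_le_add', le_div_iff₀ hab]
    nlinarith

/-- **Replica decoupling (generic).** If `f` is determined by the coordinates in `F`, then for every `g` and every
finite set `s` of inputs, `#{x ∈ s : g x = 1} − Σ_{fibres Φ} (#{x ∈ Φ : g x = 1})²/#Φ ≤ #{x ∈ s : f x ≠ g x}`,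
fibres indexed by the `F`-patterns `ρ ∈ s.image (fun x e => if e ∈ F then x e else false)`. [folklore] -/
theorem replica_decoupling_general (s : Finset (ι → Bool)) (F : Finset ι) (f g : (ι → Bool) → Bool)
    (hf : ∀ x y : ι → Bool, (∀ e ∈ F, x e = y e) → f x = f y) :
    (#(s.filter fun x => g x = true) : ℝ) -
        ∑ ρ ∈ s.image (fun x e => if e ∈ F then x e else false),
          (#(s.filter fun x => (∀ e ∈ F, x e = ρ e) ∧ g x = true) : ℝ) ^ 2 /
          #(s.filter fun x => ∀ e ∈ F, x e = ρ e) ≤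
      #(s.filter fun x => f x ≠ g x) := by
  -- fibrewise decomposition of the three counts
  have hmaps : ∀ (P : (ι → Bool) → Prop) [DecidablePred P],
      (#(s.filter P) : ℝ) = ∑ ρ ∈ s.image (fun x e => if e ∈ F then x e else false),
        (#(s.filter fun x => (∀ e ∈ F, x e = ρ e) ∧ P x) : ℝ) := by
    intro P _
    have h := Finset.card_eq_sum_card_fiberwise (f := fun (x : ι → Bool) (e : ι) => if e ∈ F then x e else false)
      (s := s.filter P) (t := s.image (fun x e => if e ∈ F then x e else false))
      (fun x hx => mem_image_of_mem _ (mem_filter.1 hx).1)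
    rw [h, Nat.cast_sum]
    refine sum_congr rfl fun ρ hρ => ?_
    congr 2
    ext x
    simp only [mem_filter]
    obtain ⟨x₀, -, rfl⟩ := mem_image.1 hρ
    rw [pattern_eq_iff]
    constructor
    · rintro ⟨⟨hxs, hP⟩, hagree⟩
      exact ⟨hxs, fun e he => by rw [hagree e he]; simp [he], hP⟩
    · rintro ⟨hxs, hagree, hP⟩
      exact ⟨⟨hxs, hP⟩, fun e he => by rw [hagree e he]; simp [he]⟩
  rw [hmaps (fun x => g x = true), hmaps (fun x => f x ≠ g x), ← sum_sub_distrib]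
  refine sum_le_sum fun ρ hρ => ?_
  obtain ⟨x₀, hx₀, rfl⟩ := mem_image.1 hρ
  -- on the fibre of `x₀`, `f` is constant `= f x₀`
  set Φ := s.filter fun x => ∀ e ∈ F, x e = (if e ∈ F then x₀ e else false) with hΦ
  set a : ℝ := (#(s.filter fun x => (∀ e ∈ F, x e = (if e ∈ F then x₀ e else false)) ∧ g x = true) : ℝ) with ha
  set b : ℝ := (#(s.filter fun x => (∀ e ∈ F, x e = (if e ∈ F then x₀ e else false)) ∧ g x = false) : ℝ) with hb
  have hab : a + b = #Φ := by
    rw [ha, hb, hΦ]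
    have h := Finset.card_filter_add_card_filter_not (s := Φ) (fun x => g x = true)
    rw [hΦ, filter_filter, filter_filter] at h
    have h' : (s.filter fun x => (∀ e ∈ F, x e = (if e ∈ F then x₀ e else false)) ∧ ¬ g x = true) =
        s.filter fun x => (∀ e ∈ F, x e = (if e ∈ F then x₀ e else false)) ∧ g x = false := by
      refine filter_congr fun x _ => ?_
      simp
    rw [h'] at h
    exact_mod_cast h
  have ha0 : 0 ≤ a := Nat.cast_nonneg _
  have hb0 : 0 ≤ b := Nat.cast_nonneg _
  -- `{f ≠ g} ∩ Φ ⊇ {g = !f x₀} ∩ Φ`, of size `a` or `b`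
  have hconst : ∀ x ∈ Φ, f x = f x₀ := by
    intro x hx
    refine hf x x₀ fun e he => ?_
    rw [(mem_filter.1 hx).2 e he]
    simp [he]
  have hge : min a b ≤ (#(s.filter fun x => (∀ e ∈ F, x e = (if e ∈ F then x₀ e else false)) ∧ f x ≠ g x) : ℝ) := by
    cases hfx : f x₀
    · -- `f = false` on the fibre: errors are `{g = true}`
      refine (min_le_left a b).trans (le_of_eq ?_)
      rw [ha]
      congr 2
      refine filter_congr fun x hx => ?_
      constructor
      · rintro ⟨hagree, hg⟩
        refine ⟨hagree, ?_⟩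
        rw [hconst x (mem_filter.2 ⟨hx, hagree⟩), hfx, hg]
        decide
      · rintro ⟨hagree, hne⟩
        refine ⟨hagree, ?_⟩
        rw [hconst x (mem_filter.2 ⟨hx, hagree⟩), hfx] at hne
        cases hg : g x
        · exact absurd hg.symm (by simpa using hne)
        · rfl
    · refine (min_le_right a b).trans (le_of_eq ?_)
      rw [hb]
      congr 2
      refine filter_congr fun x hx => ?_
      constructor
      · rintro ⟨hagree, hg⟩
        refine ⟨hagree, ?_⟩
        rw [hconst x (mem_filter.2 ⟨hx, hagree⟩), hfx, hg]
        decide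
      · rintro ⟨hagree, hne⟩
        refine ⟨hagree, ?_⟩
        rw [hconst x (mem_filter.2 ⟨hx, hagree⟩), hfx] at hne
        cases hg : g x
        · rfl
        · exact absurd hg (by simpa using hne)
  -- conclude
  by_cases hΦ0 : (#Φ : ℝ) = 0
  · have ha' : a = 0 := by linarith [hab]
    have hz : a - a ^ 2 / (#(s.filter fun x => ∀ e ∈ F, x e = (if e ∈ F then x₀ e else false)) : ℝ) = 0 := by
      rw [ha']; simp
    rw [hz]
    exact Nat.cast_nonneg _
  · have hΦpos : 0 < a + b := by
      rw [hab]
      exact lt_of_le_of_ne (Nat.cast_nonneg _) (Ne.symm hΦ0)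
    calc a - a ^ 2 / (#(s.filter fun x => ∀ e ∈ F, x e = (if e ∈ F then x₀ e else false)) : ℝ)
        = a - a ^ 2 / (a + b) := by rw [hab]
      _ ≤ min a b := sub_sq_div_le_min hb0 hΦpos
      _ ≤ _ := hge

end Generic

/-- **Replica decoupling on a slice.** For an `F`-determined `f` (e.g. a circuit reading only the slots in `F`) and any
`g` (e.g. `CLIQUE_k`): `#{x ∈ slice_j : g = 1} − Σ_Φ (#{x ∈ Φ : g = 1})²/#Φ ≤ #{x ∈ slice_j : f ≠ g}`, fibres
`Φ = {x ∈ slice_j : x|_F = ρ|_F}` indexed by the `F`-patterns `ρ ∈ (slice n j).image (fun x e => if e ∈ F then x e else false)`. [folklore] -/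
theorem replica_decoupling :
    ∀ (n j : ℕ) (F : Finset (Edge n)) (f g : (Edge n → Bool) → Bool),
      (∀ x y : Edge n → Bool, (∀ e ∈ F, x e = y e) → f x = f y) →
      (#((slice n j).filter fun x => g x = true) : ℝ) -
          ∑ ρ ∈ (slice n j).image (fun x e => if e ∈ F then x e else false),
            (#((slice n j).filter fun x => (∀ e ∈ F, x e = ρ e) ∧ g x = true) : ℝ) ^ 2 /
              #((slice n j).filter fun x => ∀ e ∈ F, x e = ρ e) ≤
        #((slice n j).filter fun x => f x ≠ g x) :=
  fun n j F f g hf => replica_decoupling_general (slice n j) F f g hf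

end

end Summit.PneNP.PneNP.Cruxes.SliceTarget.Ideator3Line
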